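import Mathlib
import HarnessLib

/-!
# Item `LrcModEntire` (stmt-NavierStokesRegularity-20428) — (TC) TUBE-CHART EXISTENCE for a planar arc

ns-k2-port-2 g5 (helper prover under the LEAD of item 20428, ns-poloidal-K2-p3 g14; `--supports stmt-NavierStokesRegularity-20428 --as helper`).
The LEAD's rung (Q1) `…LrcModEntireRidgeQuasiconvex.exists_end_ge_of_peakless` / `crossSectionMax_quasiconvexOn_of_peakless` takes a TUBE CHART
`e : OpenPartialHomeomorph (ℝ × ℝ) (ℝ × ℝ)` with `Icc a₁ a₂ ×ˢ Icc (-r) r ⊆ e.source` as a HYPOTHESIS.  This file supplies it for an actual arc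
(generic, class-free differential topology):

* `eq_zero_of_det_ne_zero`, `exists_equiv_of_det_ne_zero` — two plane vectors with `det ≠ 0` span: `(h,k) ↦ h•u + k•w` is a continuous linear
  equivalence of `ℝ × ℝ`;
* `hasFDerivAt_tube` — the derivative of the normal-bundle («tube») map `(a,n) ↦ γ a + n • ν a` at `(a,n)` is `(h,k) ↦ h•(γ′ a + n•ν′ a) + k•ν a`;
  `contDiffOn_tube` — the tube map is `C^n` on `I ×ˢ univ` when `γ, ν` are `C^n` on the open set `I`;
* `Icc_prod_Icc_subset_cthickening` — the closed rectangle `[a₁−δ, a₂+δ] × [−δ, δ]` lies in the closed `δ`-thickening of `[a₁,a₂] × {0}` (sup metric);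
* `exists_openPartialHomeomorph_of_injOn_isCompact` — the planar LOCAL-INVERSE PACKAGE (Hirsch, *Differential Topology*, Ch. 2 §1 Ex. 7; the tree's
  general Banach-space version is `Literature.Analysis.Calculus.exists_openPartialHomeomorph_contDiffOn_symm`, re-derived here in the plane from
  Mathlib alone — `ContDiffAt.toOpenPartialHomeomorph`, `Set.InjOn.exists_isOpen_superset`, `OpenPartialHomeomorph.ofContinuousOpenRestrict`,
  `OpenPartialHomeomorph.contDiffAt_symm` — to keep this file's imports at `Mathlib` + `HarnessLib`): a map `C^n` (`n ≠ 0`) on an open `U` with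
  invertible derivative at every point of `U`, injective on a compact `K ⊆ U`, IS an `OpenPartialHomeomorph e` (`⇑e = f`) with `K ⊆ e.source ⊆ U`
  and `C^n` inverse on `e.target`;
* **`exists_tubeChart`** — (TC) TRANSVERSAL-FIELD FORM: `γ, ν : ℝ → ℝ × ℝ` of class `C^n` (`n ≠ 0`, any `n : WithTop ℕ∞`, so also `ω`) on an open
  `I ⊇ [a₁,a₂]`, `ν` transversal to `γ` on `[a₁,a₂]` (`det(deriv γ a, ν a) ≠ 0`), `γ` injective on `[a₁,a₂]` ⇒ there are `ρ > 0` and an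
  `OpenPartialHomeomorph e` of `ℝ × ℝ` with `⇑e = Φ := fun p ↦ γ p.1 + p.2 • ν p.1`, `e.source = Ioo (a₁−ρ) (a₂+ρ) ×ˢ Ioo (−ρ) ρ`,
  `Icc (a₁−ρ) (a₂+ρ) ⊆ I`, and `e.symm` of class `C^n` on `e.target` (so `Icc a₁ a₂ ×ˢ Icc (−r) r ⊆ e.source` for every `r < ρ` — the `hsrc` of (Q1)).
  Proof: the package on the open set `U ⊇ [a₁,a₂] × {0}` where `det(γ′ a + n ν′ a, ν a) ≠ 0`, then a rectangle inside the source by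
  `IsCompact.exists_cthickening_subset_open`, and `OpenPartialHomeomorph.restrOpen`.
* `tube_centre`, `tube_lateral_ne_centre` — `e (a,0) = γ a`; a point `e (a,m)` with `m ≠ 0` of the tube is not on the centre arc `γ (Ioo (a₁−ρ) (a₂+ρ))`;
  `Icc_prod_Icc_subset_source` — `[a₁,a₂] × [−r,r] ⊆ e.source` for `r < ρ` (the `hsrc` of (Q1)); `exists_thinTube_subset` — thin tubes
  `e([a₁,a₂] × [−r,r])` lie in any given open `O ⊇ γ([a₁,a₂])` for `r ≤ r₀(O)`.
* **`exists_tubeChart_unitNormal`** — (TC) EUCLIDEAN UNIT-NORMAL FORM: `γ` of class `C^(n+1)` on `I`, regular (`deriv γ a ≠ 0` on `I`), injective on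
  `[a₁,a₂]`, `ν a = |γ′ a|ₑ⁻¹ • J(γ′ a)` (`J(x,y) = (−y,x)`, `|·|ₑ` the Euclidean length) ⇒ the same conclusion; with `unitNormal_facts`
  (`ν ⊥ₑ γ′`, `|ν|ₑ = 1`, `det(γ′,ν) = |γ′|ₑ > 0`, `|Φ(a,n) − γ a|ₑ² = n²`).

WHAT THIS IS NOT: not a claim about Navier–Stokes regularity — generic calculus bricks for the «ridge quasiconvexity» lever of the LEAD's memo
`Cruxes/LrcModEntire/T2B-g14.md` §9 (bears_on LADDER-NS N0, item 20428 / crux 19708; 20428/19708/27893 OPEN).  No summit statement is proved here.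
-/

noncomputable section

-- the summit and its single sub-problem share the name (CONVENTIONS §1), as in every Theorems file
set_option linter.dupNamespace false

namespace Summit.NavierStokesRegularity.NavierStokesRegularity.Theorems.PoloidalWindowDoorLrcModEntireTubeChart

open Set Filter Topology Metric

/-! ### Plane linear algebra -/

/-- Two plane vectors with non-zero determinant are linearly independent: `h•u + k•w = 0 ⇒ h = k = 0`. [folklore] -/
theorem eq_zero_of_det_ne_zero {u w : ℝ × ℝ} (hd : u.1 * w.2 - u.2 * w.1 ≠ 0) {h k : ℝ}
    (h0 : h • u + k • w = 0) : h = 0 ∧ k = 0 := by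
  have e1 : h * u.1 + k * w.1 = 0 := by simpa using congrArg Prod.fst h0
  have e2 : h * u.2 + k * w.2 = 0 := by simpa using congrArg Prod.snd h0
  have hh : h * (u.1 * w.2 - u.2 * w.1) = 0 := by linear_combination w.2 * e1 - w.1 * e2
  have hk : k * (u.1 * w.2 - u.2 * w.1) = 0 := by linear_combination u.1 * e2 - u.2 * e1
  exact ⟨(mul_eq_zero.1 hh).resolve_right hd, (mul_eq_zero.1 hk).resolve_right hd⟩

/-- For plane vectors `u, w` with `det(u,w) ≠ 0`, the linear map `(h,k) ↦ h•u + k•w` is a continuous linear equivalence of `ℝ × ℝ`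
(finite dimension: injective ⇒ bijective). [folklore] -/
theorem exists_equiv_of_det_ne_zero {u w : ℝ × ℝ} (hd : u.1 * w.2 - u.2 * w.1 ≠ 0) :
    ∃ L : (ℝ × ℝ) ≃L[ℝ] (ℝ × ℝ), (L : (ℝ × ℝ) →L[ℝ] (ℝ × ℝ)) =
      (ContinuousLinearMap.fst ℝ ℝ ℝ).smulRight u + (ContinuousLinearMap.snd ℝ ℝ ℝ).smulRight w := by
  set M : (ℝ × ℝ) →L[ℝ] (ℝ × ℝ) :=
    (ContinuousLinearMap.fst ℝ ℝ ℝ).smulRight u + (ContinuousLinearMap.snd ℝ ℝ ℝ).smulRight w with hM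
  have hMapp : ∀ p : ℝ × ℝ, M p = p.1 • u + p.2 • w := fun p => by simp [hM]
  have hinj : Function.Injective M := by
    refine (injective_iff_map_eq_zero M).2 fun p hp => ?_
    rw [hMapp] at hp
    obtain ⟨h1, h2⟩ := eq_zero_of_det_ne_zero hd hp
    exact Prod.ext h1 h2
  exact ⟨(LinearEquiv.ofInjectiveEndo M.toLinearMap hinj).toContinuousLinearEquiv, ContinuousLinearMap.ext fun p => rfl⟩

/-! ### The tube map `(a, n) ↦ γ a + n • ν a` -/

variable {γ ν : ℝ → ℝ × ℝ} {I : Set ℝ}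

/-- **Derivative of the tube map.**  If `γ, ν` have derivatives `γ′, ν′` at `a`, then `(a,n) ↦ γ a + n • ν a` has derivative
`(h,k) ↦ h • (γ′ + n • ν′) + k • ν a` at `(a, n)`. [folklore] -/
theorem hasFDerivAt_tube {γ' ν' : ℝ × ℝ} {a : ℝ} (hγ : HasDerivAt γ γ' a) (hν : HasDerivAt ν ν' a) (n : ℝ) :
    HasFDerivAt (fun p : ℝ × ℝ => γ p.1 + p.2 • ν p.1)
      ((ContinuousLinearMap.fst ℝ ℝ ℝ).smulRight (γ' + n • ν') + (ContinuousLinearMap.snd ℝ ℝ ℝ).smulRight (ν a)) (a, n) := by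
  have h1 : HasFDerivAt (fun p : ℝ × ℝ => γ p.1)
      ((ContinuousLinearMap.smulRight (1 : ℝ →L[ℝ] ℝ) γ').comp (ContinuousLinearMap.fst ℝ ℝ ℝ)) (a, n) :=
    hγ.hasFDerivAt.comp (a, n) hasFDerivAt_fst
  have h2 : HasFDerivAt (fun p : ℝ × ℝ => ν p.1)
      ((ContinuousLinearMap.smulRight (1 : ℝ →L[ℝ] ℝ) ν').comp (ContinuousLinearMap.fst ℝ ℝ ℝ)) (a, n) :=
    hν.hasFDerivAt.comp (a, n) hasFDerivAt_fst
  have h3 : HasFDerivAt (fun p : ℝ × ℝ => p.2) (ContinuousLinearMap.snd ℝ ℝ ℝ) (a, n) := hasFDerivAt_snd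
  have h4 := h1.fun_add (h3.fun_smul h2)
  refine h4.congr_fderiv ?_
  ext <;> simp

/-- **The tube map is `C^n` on `I ×ˢ univ`** when `γ, ν` are `C^n` on `I`. [folklore] -/
theorem contDiffOn_tube {n : WithTop ℕ∞} (hγ : ContDiffOn ℝ n γ I) (hν : ContDiffOn ℝ n ν I) :
    ContDiffOn ℝ n (fun p : ℝ × ℝ => γ p.1 + p.2 • ν p.1) (I ×ˢ (univ : Set ℝ)) := by
  have hfst : MapsTo (Prod.fst : ℝ × ℝ → ℝ) (I ×ˢ (univ : Set ℝ)) I := fun p hp => hp.1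
  have h1 : ContDiffOn ℝ n (fun p : ℝ × ℝ => γ p.1) (I ×ˢ (univ : Set ℝ)) := hγ.comp contDiffOn_fst hfst
  have h2 : ContDiffOn ℝ n (fun p : ℝ × ℝ => ν p.1) (I ×ˢ (univ : Set ℝ)) := hν.comp contDiffOn_fst hfst
  exact h1.add (contDiffOn_snd.smul h2)

/-! ### A rectangle inside a neighbourhood of a segment -/

/-- In the sup metric of `ℝ × ℝ`, the closed rectangle `[a₁−δ, a₂+δ] × [−δ, δ]` lies in the closed `δ`-thickening of the segment `[a₁,a₂] × {0}`
(`a₁ ≤ a₂`, `0 ≤ δ`). [folklore] -/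
theorem Icc_prod_Icc_subset_cthickening {a₁ a₂ δ : ℝ} (h12 : a₁ ≤ a₂) (hδ : 0 ≤ δ) :
    Icc (a₁ - δ) (a₂ + δ) ×ˢ Icc (-δ) δ ⊆ cthickening δ (Icc a₁ a₂ ×ˢ ({0} : Set ℝ)) := by
  rintro ⟨a, m⟩ ⟨⟨ha1, ha2⟩, ⟨hm1, hm2⟩⟩
  dsimp only at ha1 ha2 hm1 hm2
  -- the nearest point of the segment
  set b : ℝ := max a₁ (min a a₂) with hb
  have hbI : b ∈ Icc a₁ a₂ := ⟨le_max_left _ _, max_le h12 (min_le_right _ _)⟩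
  have hab : dist a b ≤ δ := by
    rw [Real.dist_eq]
    rcases le_total a a₁ with h1 | h1
    · have hb' : b = a₁ := by rw [hb, min_eq_left (h1.trans h12), max_eq_left h1]
      rw [hb', abs_le]; constructor <;> linarith
    · rcases le_total a a₂ with h2 | h2
      · have hb' : b = a := by rw [hb, min_eq_left h2, max_eq_right h1]
        rw [hb', sub_self, abs_zero]; exact hδ
      · have hb' : b = a₂ := by rw [hb, min_eq_right h2, max_eq_right h12]
        rw [hb', abs_le]; constructor <;> linarith
  refine mem_cthickening_of_dist_le (a, m) (b, 0) δ _ ⟨hbI, rfl⟩ ?_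
  rw [Prod.dist_eq]
  refine max_le hab ?_
  rw [Real.dist_eq, sub_zero]
  exact abs_le.2 ⟨hm1, hm2⟩

/-! ### The local-inverse package along a compact set (planar) -/

/-- **A `C^n` map with invertible derivative, injective on a compact set, is a `C^n` diffeomorphism onto an open set on a neighbourhood of it**
(planar version; Hirsch, *Differential Topology*, Ch. 2 §1 Ex. 7; general Banach version: `Literature.Analysis.Calculus.exists_openPartialHomeomorph_contDiffOn_symm`).
Let `f` be `C^n` (`n ≠ 0`) on the open `U` with derivative a continuous linear equivalence at every point of `U`, and injective on the compact `K ⊆ U`.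
Then there is an open partial homeomorphism `e` which IS `f` (`⇑e = f`), with `K ⊆ e.source ⊆ U`, whose inverse is `C^n` on `e.target`. [folklore] -/
theorem exists_openPartialHomeomorph_of_injOn_isCompact {n : WithTop ℕ∞} (hn : n ≠ 0) {f : ℝ × ℝ → ℝ × ℝ} {U K : Set (ℝ × ℝ)}
    (hU : IsOpen U) (hKU : K ⊆ U) (hK : IsCompact K) (hf : ContDiffOn ℝ n f U)
    (hf' : ∀ x ∈ U, ∃ f' : (ℝ × ℝ) ≃L[ℝ] (ℝ × ℝ), HasFDerivAt f (f' : (ℝ × ℝ) →L[ℝ] (ℝ × ℝ)) x) (hinj : InjOn f K) :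
    ∃ e : OpenPartialHomeomorph (ℝ × ℝ) (ℝ × ℝ), ⇑e = f ∧ K ⊆ e.source ∧ e.source ⊆ U ∧ ContDiffOn ℝ n e.symm e.target := by
  -- `f` is a local homeomorphism on `U` (inverse function theorem at each point)
  have hloc : IsLocalHomeomorphOn f U := by
    refine IsLocalHomeomorphOn.mk f U fun x hx => ?_
    obtain ⟨f', hfx'⟩ := hf' x hx
    have hfx : ContDiffAt ℝ n f x := hf.contDiffAt (hU.mem_nhds hx)
    exact ⟨hfx.toOpenPartialHomeomorph f hfx' hn, hfx.mem_toOpenPartialHomeomorph_source hfx' hn, fun y _ => rfl⟩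
  -- injectivity spreads from `K` to an open `V`, `K ⊆ V ⊆ U`
  obtain ⟨t, hto, hKt, ht⟩ := hinj.exists_isOpen_superset hK (fun x hx => hloc.continuousAt (hKU hx)) fun x hx => by
    obtain ⟨e, hxe, heq⟩ := hloc x (hKU hx)
    exact ⟨e.source, e.open_source.mem_nhds hxe, fun a ha b hb hab => e.injOn ha hb (by rwa [heq] at hab)⟩
  set V : Set (ℝ × ℝ) := t ∩ U with hV
  have hVo : IsOpen V := hto.inter hU
  have hKV : K ⊆ V := subset_inter hKt hKU
  have hVU : V ⊆ U := inter_subset_right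
  have hinjV : InjOn f V := ht.mono inter_subset_left
  have hlocV : IsLocalHomeomorphOn f V := hloc.mono hVU
  -- `f` restricted to `V` is an open map
  have hopen : IsOpenMap (V.restrict f) := by
    rw [isOpenMap_iff_nhds_le]
    rintro ⟨x, hx⟩
    have h1 : map f (𝓝 x) = 𝓝 (f x) := hlocV.map_nhds_eq hx
    have h2 : map (Subtype.val : V → ℝ × ℝ) (𝓝 ⟨x, hx⟩) = 𝓝 x := by
      rw [map_nhds_subtype_val, hVo.nhdsWithin_eq hx]
    have h3 : V.restrict f = f ∘ (Subtype.val : V → ℝ × ℝ) := rfl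
    rw [h3, ← Filter.map_map, h2, h1]
    exact le_rfl
  -- the package
  set P : PartialEquiv (ℝ × ℝ) (ℝ × ℝ) := hinjV.toPartialEquiv f V with hP
  have hPsrc : P.source = V := rfl
  have hPcoe : ⇑P = f := rfl
  set e : OpenPartialHomeomorph (ℝ × ℝ) (ℝ × ℝ) := OpenPartialHomeomorph.ofContinuousOpenRestrict P
    (by rw [hPsrc, hPcoe]; exact hlocV.continuousOn) (by rw [hPsrc, hPcoe]; exact hopen) (by rw [hPsrc]; exact hVo) with he
  have hecoe : ⇑e = f := rfl
  have hesrc : e.source = V := rfl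
  refine ⟨e, hecoe, by rw [hesrc]; exact hKV, by rw [hesrc]; exact hVU, fun y hy => ?_⟩
  have hx : e.symm y ∈ V := by rw [← hesrc]; exact e.map_target hy
  obtain ⟨f', hfx'⟩ := hf' _ (hVU hx)
  have hfx : ContDiffAt ℝ n f (e.symm y) := hf.contDiffAt (hU.mem_nhds (hVU hx))
  exact (e.contDiffAt_symm hy (by rw [hecoe]; exact hfx') (by rw [hecoe]; exact hfx)).contDiffWithinAt

/-! ### (TC) Tube-chart existence — transversal-field form -/

/-- **(TC) TUBE-CHART EXISTENCE (transversal-field form).**  Let `γ, ν : ℝ → ℝ × ℝ` be `C^n` (`n ≠ 0`; any `n : WithTop ℕ∞`, e.g. `1, 2, ∞, ω`) on an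
open set `I ⊇ [a₁, a₂]` (`a₁ ≤ a₂`), with `ν` transversal to the arc on the core (`det(deriv γ a, ν a) ≠ 0` for `a ∈ [a₁,a₂]`) and `γ` injective on
`[a₁,a₂]`.  Then for some `ρ > 0` the tube map `Φ (a,n) = γ a + n • ν a`, restricted to the open rectangle `(a₁−ρ, a₂+ρ) × (−ρ, ρ)`, IS an
`OpenPartialHomeomorph` of `ℝ × ℝ` (`⇑e = Φ`, `e.source` = that rectangle, `[a₁−ρ, a₂+ρ] ⊆ I`), with inverse of class `C^n` on the (open) image
`e.target`.  In particular `Icc a₁ a₂ ×ˢ Icc (−r) r ⊆ e.source` for every `0 ≤ r < ρ`. [folklore] (Hirsch, *Differential Topology*, Ch. 2 §1 Ex. 7 /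
Ch. 4 Thm. 5.1, the planar case.) -/
theorem exists_tubeChart {n : WithTop ℕ∞} (hn : n ≠ 0) (hI : IsOpen I) {a₁ a₂ : ℝ} (h12 : a₁ ≤ a₂) (hsub : Icc a₁ a₂ ⊆ I)
    (hγ : ContDiffOn ℝ n γ I) (hν : ContDiffOn ℝ n ν I)
    (htr : ∀ a ∈ Icc a₁ a₂, (deriv γ a).1 * (ν a).2 - (deriv γ a).2 * (ν a).1 ≠ 0) (hinj : InjOn γ (Icc a₁ a₂))
    {Φ : ℝ × ℝ → ℝ × ℝ} (hΦ : ∀ p, Φ p = γ p.1 + p.2 • ν p.1) :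
    ∃ (e : OpenPartialHomeomorph (ℝ × ℝ) (ℝ × ℝ)) (ρ : ℝ), 0 < ρ ∧ ⇑e = Φ ∧
      e.source = Ioo (a₁ - ρ) (a₂ + ρ) ×ˢ Ioo (-ρ) ρ ∧ Icc (a₁ - ρ) (a₂ + ρ) ⊆ I ∧ ContDiffOn ℝ n e.symm e.target := by
  have hΦeq : Φ = fun p : ℝ × ℝ => γ p.1 + p.2 • ν p.1 := funext hΦ
  have h1n : (1 : WithTop ℕ∞) ≤ n := ENat.one_le_iff_ne_zero_withTop.mpr hn
  -- derivatives of `γ`, `ν` on `I` and their continuity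
  have hγd : ∀ a ∈ I, HasDerivAt γ (deriv γ a) a := fun a ha =>
    ((hγ.differentiableOn hn).differentiableAt (hI.mem_nhds ha)).hasDerivAt
  have hνd : ∀ a ∈ I, HasDerivAt ν (deriv ν a) a := fun a ha =>
    ((hν.differentiableOn hn).differentiableAt (hI.mem_nhds ha)).hasDerivAt
  have hγ'c : ContinuousOn (deriv γ) I := hγ.continuousOn_deriv_of_isOpen hI h1n
  have hν'c : ContinuousOn (deriv ν) I := hν.continuousOn_deriv_of_isOpen hI h1n
  have hνc : ContinuousOn ν I := hν.continuousOn
  -- the open set `U` where the derivative of the tube map is invertible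
  set D : ℝ × ℝ → ℝ := fun p =>
    (deriv γ p.1 + p.2 • deriv ν p.1).1 * (ν p.1).2 - (deriv γ p.1 + p.2 • deriv ν p.1).2 * (ν p.1).1 with hD
  set W : Set (ℝ × ℝ) := I ×ˢ (univ : Set ℝ) with hW
  have hWo : IsOpen W := hI.prod isOpen_univ
  have hfst : MapsTo (Prod.fst : ℝ × ℝ → ℝ) W I := fun p hp => hp.1
  have hDc : ContinuousOn D W := by
    have hA : ContinuousOn (fun p : ℝ × ℝ => deriv γ p.1 + p.2 • deriv ν p.1) W :=
      (hγ'c.comp continuousOn_fst hfst).add (continuousOn_snd.smul (hν'c.comp continuousOn_fst hfst))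
    have hB : ContinuousOn (fun p : ℝ × ℝ => ν p.1) W := hνc.comp continuousOn_fst hfst
    exact ((continuous_fst.comp_continuousOn hA).mul (continuous_snd.comp_continuousOn hB)).sub
      ((continuous_snd.comp_continuousOn hA).mul (continuous_fst.comp_continuousOn hB))
  set U : Set (ℝ × ℝ) := W ∩ D ⁻¹' ({0}ᶜ) with hU
  have hUo : IsOpen U := hDc.isOpen_inter_preimage hWo isOpen_compl_singleton
  have hUW : U ⊆ W := inter_subset_left
  -- the compact core `K = [a₁,a₂] × {0}`
  set K : Set (ℝ × ℝ) := Icc a₁ a₂ ×ˢ ({0} : Set ℝ) with hK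
  have hKc : IsCompact K := isCompact_Icc.prod isCompact_singleton
  have hKU : K ⊆ U := by
    rintro ⟨a, m⟩ ⟨ha, hm⟩
    have hm0 : m = 0 := hm
    subst hm0
    refine ⟨⟨hsub ha, mem_univ _⟩, ?_⟩
    show D (a, 0) ∈ ({0}ᶜ : Set ℝ)
    rw [mem_compl_singleton_iff, hD]
    simpa using htr a ha
  -- smoothness, derivative and injectivity of `Φ`
  have hΦU : ContDiffOn ℝ n Φ U := by
    rw [hΦeq]; exact (contDiffOn_tube hγ hν).mono hUW
  have hΦ' : ∀ p ∈ U, ∃ L : (ℝ × ℝ) ≃L[ℝ] (ℝ × ℝ), HasFDerivAt Φ (L : (ℝ × ℝ) →L[ℝ] (ℝ × ℝ)) p := by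
    rintro ⟨a, m⟩ ⟨⟨ha, -⟩, hDp⟩
    have hDp' : D (a, m) ≠ 0 := hDp
    obtain ⟨L, hL⟩ := exists_equiv_of_det_ne_zero (u := deriv γ a + m • deriv ν a) (w := ν a) (by simpa [hD] using hDp')
    refine ⟨L, ?_⟩
    rw [hL, hΦeq]
    exact hasFDerivAt_tube (hγd a ha) (hνd a ha) m
  have hinjK : InjOn Φ K := by
    rintro ⟨a, m⟩ ⟨ha, hm⟩ ⟨a', m'⟩ ⟨ha', hm'⟩ h
    have hm0 : m = 0 := hm
    have hm0' : m' = 0 := hm'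
    subst hm0 hm0'
    have h' : γ a = γ a' := by simpa [hΦ] using h
    exact Prod.ext (hinj ha ha' h') rfl
  -- the package: an open partial homeomorphism which is `Φ` near `K`
  obtain ⟨e₀, he₀, hKe₀, he₀U, hsymm⟩ := exists_openPartialHomeomorph_of_injOn_isCompact hn hUo hKU hKc hΦU hΦ' hinjK
  -- a rectangle inside the source
  obtain ⟨δ, hδ, hδsub⟩ := hKc.exists_cthickening_subset_open e₀.open_source hKe₀
  have hrect : Icc (a₁ - δ) (a₂ + δ) ×ˢ Icc (-δ) δ ⊆ e₀.source :=
    (Icc_prod_Icc_subset_cthickening h12 hδ.le).trans hδsub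
  set R : Set (ℝ × ℝ) := Ioo (a₁ - δ) (a₂ + δ) ×ˢ Ioo (-δ) δ with hR
  have hRo : IsOpen R := isOpen_Ioo.prod isOpen_Ioo
  have hRsub : R ⊆ e₀.source := (Set.prod_mono Ioo_subset_Icc_self Ioo_subset_Icc_self).trans hrect
  refine ⟨e₀.restrOpen R hRo, δ, hδ, ?_, ?_, ?_, ?_⟩
  · rw [OpenPartialHomeomorph.coe_restrOpen, he₀]
  · rw [OpenPartialHomeomorph.restrOpen_source, inter_eq_right.2 hRsub]
  · intro a ha
    have : (a, (0 : ℝ)) ∈ e₀.source := hrect ⟨ha, ⟨by linarith, hδ.le⟩⟩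
    exact (hUW (he₀U this)).1
  · rw [OpenPartialHomeomorph.coe_restrOpen_symm]
    exact hsymm.mono (by
      rw [OpenPartialHomeomorph.restrOpen_toPartialEquiv, PartialEquiv.restr_target]
      exact inter_subset_left)

/-- **Centre of the tube**: `e (a, 0) = γ a`. -/
theorem tube_centre {Φ : ℝ × ℝ → ℝ × ℝ} (hΦ : ∀ p, Φ p = γ p.1 + p.2 • ν p.1) (a : ℝ) : Φ (a, 0) = γ a := by
  simp [hΦ]

/-- **Lateral points are off the centre arc**: if `e` is injective on the rectangle `(a₁−ρ, a₂+ρ) × (−ρ, ρ)` and is the tube map there, then a tube point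
`e (a, m)` with `m ≠ 0` is not a centre point `γ a'`, `a' ∈ (a₁−ρ, a₂+ρ)`. [folklore] -/
theorem tube_lateral_ne_centre (e : OpenPartialHomeomorph (ℝ × ℝ) (ℝ × ℝ)) {Φ : ℝ × ℝ → ℝ × ℝ} (hΦ : ∀ p, Φ p = γ p.1 + p.2 • ν p.1)
    (he : ⇑e = Φ) {a₁ a₂ ρ : ℝ} (hsrc : e.source = Ioo (a₁ - ρ) (a₂ + ρ) ×ˢ Ioo (-ρ) ρ)
    {a m : ℝ} (ha : a ∈ Ioo (a₁ - ρ) (a₂ + ρ)) (hm : m ∈ Ioo (-ρ) ρ) (hm0 : m ≠ 0) {a' : ℝ} (ha' : a' ∈ Ioo (a₁ - ρ) (a₂ + ρ)) :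
    e (a, m) ≠ γ a' := by
  intro h
  have hρ : 0 < ρ := by have := hm.1; have := hm.2; linarith
  have h1 : (a, m) ∈ e.source := by rw [hsrc]; exact ⟨ha, hm⟩
  have h2 : (a', (0 : ℝ)) ∈ e.source := by rw [hsrc]; exact ⟨ha', ⟨by linarith, hρ⟩⟩
  have h3 : e (a, m) = e (a', 0) := by rw [h, he, tube_centre hΦ]
  have := e.injOn h1 h2 h3
  exact hm0 (by simpa using congrArg Prod.snd this)

/-- **The closed sub-rectangles `[a₁,a₂] × [−r,r]`, `r < ρ`, lie in the source** — the `hsrc` hypothesis of the LEAD's (Q1)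
`…LrcModEntireRidgeQuasiconvex.exists_end_ge_of_peakless` / `crossSectionMax_quasiconvexOn_of_peakless`. -/
theorem Icc_prod_Icc_subset_source (e : OpenPartialHomeomorph (ℝ × ℝ) (ℝ × ℝ)) {a₁ a₂ ρ r : ℝ}
    (hsrc : e.source = Ioo (a₁ - ρ) (a₂ + ρ) ×ˢ Ioo (-ρ) ρ) (hr : r < ρ) : Icc a₁ a₂ ×ˢ Icc (-r) r ⊆ e.source := by
  rw [hsrc]
  rintro ⟨a, m⟩ ⟨⟨ha1, ha2⟩, ⟨hm1, hm2⟩⟩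
  dsimp only at ha1 ha2 hm1 hm2
  exact ⟨⟨by linarith, by linarith⟩, ⟨by linarith, by linarith⟩⟩

/-- **Thin tubes shrink onto the arc**: for every open `O ⊇ γ([a₁,a₂])` there is `r₀ ∈ (0, ρ)` with `e([a₁,a₂] × [−r,r]) ⊆ O` for all `0 ≤ r ≤ r₀`
(compactness of `[a₁,a₂] × {0}` in the open set `e.source ∩ e⁻¹(O)`). [folklore] -/
theorem exists_thinTube_subset (e : OpenPartialHomeomorph (ℝ × ℝ) (ℝ × ℝ)) {Φ : ℝ × ℝ → ℝ × ℝ} (hΦ : ∀ p, Φ p = γ p.1 + p.2 • ν p.1)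
    (he : ⇑e = Φ) {a₁ a₂ ρ : ℝ} (hρ : 0 < ρ) (hsrc : e.source = Ioo (a₁ - ρ) (a₂ + ρ) ×ˢ Ioo (-ρ) ρ)
    {O : Set (ℝ × ℝ)} (hO : IsOpen O) (hγO : MapsTo γ (Icc a₁ a₂) O) :
    ∃ r₀, 0 < r₀ ∧ r₀ < ρ ∧ ∀ r, r ≤ r₀ → e '' (Icc a₁ a₂ ×ˢ Icc (-r) r) ⊆ O := by
  have hpre : IsOpen (e.source ∩ e ⁻¹' O) := e.continuousOn.isOpen_inter_preimage e.open_source hO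
  have hK : Icc a₁ a₂ ×ˢ ({0} : Set ℝ) ⊆ e.source ∩ e ⁻¹' O := by
    rintro ⟨a, m⟩ ⟨ha, hm⟩
    have hm0 : m = 0 := hm
    subst hm0
    refine ⟨by rw [hsrc]; exact ⟨⟨by linarith [ha.1], by linarith [ha.2]⟩, ⟨by linarith, hρ⟩⟩, ?_⟩
    show e (a, 0) ∈ O
    rw [he, tube_centre hΦ]
    exact hγO ha
  obtain ⟨δ, hδ, hδsub⟩ := (isCompact_Icc.prod isCompact_singleton).exists_cthickening_subset_open hpre hK
  refine ⟨min δ (ρ / 2), lt_min hδ (by linarith), (min_le_right _ _).trans_lt (by linarith), fun r hr => ?_⟩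
  rintro _ ⟨p, hp, rfl⟩
  have h12 : a₁ ≤ a₂ := hp.1.1.trans hp.1.2
  have hrδ : r ≤ δ := hr.trans (min_le_left _ _)
  have hp' : p ∈ Icc (a₁ - δ) (a₂ + δ) ×ˢ Icc (-δ) δ :=
    ⟨⟨by linarith [hp.1.1], by linarith [hp.1.2]⟩, ⟨by linarith [hp.2.1], by linarith [hp.2.2]⟩⟩
  exact (hδsub (Icc_prod_Icc_subset_cthickening h12 hδ.le hp')).2

/-! ### (TC) Euclidean unit-normal form -/

/-- **Facts about the Euclidean unit normal** `ν a = |γ′ a|ₑ⁻¹ • J(γ′ a)` of a regular arc (`J(x,y) = (−y,x)`, `|w|ₑ = √(w.1² + w.2²)`): at a point with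
`deriv γ a ≠ 0`, `ν a ⊥ₑ γ′ a`, `|ν a|ₑ = 1`, `det(γ′ a, ν a) = |γ′ a|ₑ > 0`, and the tube point `γ a + n • ν a` is at Euclidean distance `|n|` from
`γ a` (`(n • ν a).1² + (n • ν a).2² = n²`). [folklore] -/
theorem unitNormal_facts {a : ℝ} (hreg : deriv γ a ≠ 0)
    (hνa : ν a = (Real.sqrt ((deriv γ a).1 ^ 2 + (deriv γ a).2 ^ 2))⁻¹ • (-(deriv γ a).2, (deriv γ a).1)) :
    0 < Real.sqrt ((deriv γ a).1 ^ 2 + (deriv γ a).2 ^ 2) ∧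
    (ν a).1 * (deriv γ a).1 + (ν a).2 * (deriv γ a).2 = 0 ∧ (ν a).1 ^ 2 + (ν a).2 ^ 2 = 1 ∧
    (deriv γ a).1 * (ν a).2 - (deriv γ a).2 * (ν a).1 = Real.sqrt ((deriv γ a).1 ^ 2 + (deriv γ a).2 ^ 2) ∧
    ∀ n : ℝ, (n • ν a).1 ^ 2 + (n • ν a).2 ^ 2 = n ^ 2 := by
  set x := (deriv γ a).1 with hx
  set y := (deriv γ a).2 with hy
  have hpos : 0 < x ^ 2 + y ^ 2 := by
    rcases (Prod.ext_iff.not.1 (show deriv γ a ≠ (0 : ℝ × ℝ) from hreg)) |> not_and_or.1 with h | h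
    · have : x ≠ 0 := h
      positivity
    · have : y ≠ 0 := h
      positivity
  set s := Real.sqrt (x ^ 2 + y ^ 2) with hs
  have hs0 : 0 < s := Real.sqrt_pos.2 hpos
  have hss : s * s = x ^ 2 + y ^ 2 := Real.mul_self_sqrt hpos.le
  have hν1 : (ν a).1 = -y / s := by rw [hνa]; simp [div_eq_inv_mul]
  have hν2 : (ν a).2 = x / s := by rw [hνa]; simp [div_eq_inv_mul]
  refine ⟨hs0, ?_, ?_, ?_, fun n => ?_⟩
  · rw [hν1, hν2]; field_simp; ring
  · rw [hν1, hν2]; field_simp; linarith [hss]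
  · rw [hν1, hν2]; field_simp; linarith [hss]
  · simp only [Prod.smul_fst, Prod.smul_snd, smul_eq_mul]
    rw [hν1, hν2]; field_simp; linear_combination n ^ 2 * hss.symm

/-- **The Euclidean unit normal of a regular `C^(n+1)` arc is `C^n`.** [folklore] -/
theorem contDiffOn_unitNormal {n : WithTop ℕ∞} (hI : IsOpen I) (hγ : ContDiffOn ℝ (n + 1) γ I) (hreg : ∀ a ∈ I, deriv γ a ≠ 0)
    (hν : ∀ a ∈ I, ν a = (Real.sqrt ((deriv γ a).1 ^ 2 + (deriv γ a).2 ^ 2))⁻¹ • (-(deriv γ a).2, (deriv γ a).1)) :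
    ContDiffOn ℝ n ν I := by
  have hd : ContDiffOn ℝ n (deriv γ) I := hγ.deriv_of_isOpen hI le_rfl
  have hd1 : ContDiffOn ℝ n (fun a => (deriv γ a).1) I := contDiff_fst.comp_contDiffOn hd
  have hd2 : ContDiffOn ℝ n (fun a => (deriv γ a).2) I := contDiff_snd.comp_contDiffOn hd
  have hq : ContDiffOn ℝ n (fun a => (deriv γ a).1 ^ 2 + (deriv γ a).2 ^ 2) I := (hd1.pow 2).add (hd2.pow 2)
  have hq0 : ∀ a ∈ I, (deriv γ a).1 ^ 2 + (deriv γ a).2 ^ 2 ≠ 0 := fun a ha =>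
    (Real.sqrt_pos.1 (unitNormal_facts (ν := fun b => (Real.sqrt ((deriv γ b).1 ^ 2 + (deriv γ b).2 ^ 2))⁻¹ • (-(deriv γ b).2, (deriv γ b).1))
      (hreg a ha) rfl).1).ne'
  have hsq : ContDiffOn ℝ n (fun a => Real.sqrt ((deriv γ a).1 ^ 2 + (deriv γ a).2 ^ 2)) I := hq.sqrt hq0
  have hsq0 : ∀ a ∈ I, Real.sqrt ((deriv γ a).1 ^ 2 + (deriv γ a).2 ^ 2) ≠ 0 := fun a ha =>
    (unitNormal_facts (ν := fun b => (Real.sqrt ((deriv γ b).1 ^ 2 + (deriv γ b).2 ^ 2))⁻¹ • (-(deriv γ b).2, (deriv γ b).1))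
      (hreg a ha) rfl).1.ne'
  have hinv : ContDiffOn ℝ n (fun a => (Real.sqrt ((deriv γ a).1 ^ 2 + (deriv γ a).2 ^ 2))⁻¹) I := hsq.inv hsq0
  have hJ : ContDiffOn ℝ n (fun a => ((-(deriv γ a).2, (deriv γ a).1) : ℝ × ℝ)) I := hd2.neg.prodMk hd1
  exact (hinv.smul hJ).congr fun a ha => hν a ha

/-- **(TC) TUBE-CHART EXISTENCE (Euclidean unit-normal form).**  Let `γ : ℝ → ℝ × ℝ` be of class `C^(n+1)` (`n ≠ 0`) on an open `I ⊇ [a₁,a₂]`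
(`a₁ ≤ a₂`), regular on `I` (`deriv γ a ≠ 0`) and injective on `[a₁,a₂]`, and let `ν` be its Euclidean unit normal on `I`
(`ν a = |γ′ a|ₑ⁻¹ • (−(γ′ a).2, (γ′ a).1)`).  Then for some `ρ > 0` the normal-bundle map `Φ (a,n) = γ a + n • ν a` restricted to
`(a₁−ρ, a₂+ρ) × (−ρ, ρ)` is an `OpenPartialHomeomorph e` of `ℝ × ℝ` (`⇑e = Φ`, `e.source` = the rectangle, `[a₁−ρ,a₂+ρ] ⊆ I`) with `C^n` inverse on
`e.target`; `e (a,0) = γ a` (`tube_centre`) and `e (a, n)` is at Euclidean distance `|n|` from `γ a` (`unitNormal_facts`). [folklore] -/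
theorem exists_tubeChart_unitNormal {n : WithTop ℕ∞} (hn : n ≠ 0) (hI : IsOpen I) {a₁ a₂ : ℝ} (h12 : a₁ ≤ a₂) (hsub : Icc a₁ a₂ ⊆ I)
    (hγ : ContDiffOn ℝ (n + 1) γ I) (hreg : ∀ a ∈ I, deriv γ a ≠ 0) (hinj : InjOn γ (Icc a₁ a₂))
    (hν : ∀ a ∈ I, ν a = (Real.sqrt ((deriv γ a).1 ^ 2 + (deriv γ a).2 ^ 2))⁻¹ • (-(deriv γ a).2, (deriv γ a).1))
    {Φ : ℝ × ℝ → ℝ × ℝ} (hΦ : ∀ p, Φ p = γ p.1 + p.2 • ν p.1) :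
    ∃ (e : OpenPartialHomeomorph (ℝ × ℝ) (ℝ × ℝ)) (ρ : ℝ), 0 < ρ ∧ ⇑e = Φ ∧
      e.source = Ioo (a₁ - ρ) (a₂ + ρ) ×ˢ Ioo (-ρ) ρ ∧ Icc (a₁ - ρ) (a₂ + ρ) ⊆ I ∧ ContDiffOn ℝ n e.symm e.target := by
  have hνn : ContDiffOn ℝ n ν I := contDiffOn_unitNormal hI hγ hreg hν
  have hγn : ContDiffOn ℝ n γ I := hγ.of_le le_self_add
  refine exists_tubeChart hn hI h12 hsub hγn hνn (fun a ha => ?_) hinj hΦ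
  rw [(unitNormal_facts (hreg a (hsub ha)) (hν a (hsub ha))).2.2.2.1]
  exact (unitNormal_facts (hreg a (hsub ha)) (hν a (hsub ha))).1.ne'

end Summit.NavierStokesRegularity.NavierStokesRegularity.Theorems.PoloidalWindowDoorLrcModEntireTubeChart

end
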